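import Mathlib.Analysis.Complex.Basic
import Mathlib.Algebra.BigOperators.Field
import Mathlib.Analysis.SpecialFunctions.Exp
import Mathlib.Analysis.SumOverResidueClass
import Mathlib.Topology.Algebra.InfiniteSum.Real
import HarnessLib

/-!
# Konieczny 2020, §5 for quasimultiplicative sequences: many bad windows force `𝔼 g → 0`

Topic `Literature/NumberTheory/LFunctions`. Everything in this file is PROVED. It renders the
direction (1) ⇒ (2) of Proposition 5.4 of J. Konieczny, *Möbius orthogonality for
q-semimultiplicative sequences*, Monatsh. Math. 192 (2020) (arXiv:1808.06196, §5), i.e. the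
content of Lemma 5.3 ("global ≥ local") together with the covering argument, in the following
quantitative-enough form.  For `g : ℕ → ℂ` write, for a WINDOW of digit positions `[k, k+l)`,

  `Λ_{k,l}(g) = ‖q^{-l} ∑_{c < q^l} g(c q^k)‖ ∈ [0, 1]`,   `δ_{k,l}(g) = 1 - Λ_{k,l}(g)`

(the paper's `λ_f^I` and `1 - λ_f^I`; we use `δ` instead of the paper's `ε = -log λ`).

* `Konieczny.IsQuasimult q s g` — Definition 3.1: `g` is `q`-quasimultiplicative with gap `≤ s`,
  `g(x + y) = g(x) g(y)` whenever `y < q^l` and `q^{l+s} ∣ x`.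
* `Konieczny.zones_bound` — (Lemma 5.3, multiplicative form) if `[k_j, k_j + l)`, `j = 0, 1, …`
  are windows with `k_0 ≥ s`, `k_{j+1} ≥ k_j + l + 2s`, then for every `K ≥ k_{t-1} + l + s` and
  every `w` with `q^K ∣ w`:
  `‖∑_{b < q^K} g(w + b)‖ ≤ q^K ∏_{j<t} (1 - δ_{k_j,l}(g) / q^{2s})`.
  (Proof: condition on the `s` digits below and above the top window being zero — probability
  `q^{-2s}` — in which case quasimultiplicativity factors the window average out; induct.)
* `Konieczny.tendsto_avg_of_not_summable_delta` — consequently, if for some `l` the defects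
  `δ_{k,l}(g)`, `k = 0, 1, 2, …` are NOT summable, then `𝔼_{n<N} g(n) → 0`.  Contrapositively
  (this is how §8 of the paper uses Proposition 5.4): if `𝔼_{n<N} g(n) ↛ 0` then
  `∑_k δ_{k,l}(g) < ∞` for every `l`.
-/

noncomputable section

open Filter Finset
open scoped Topology

namespace Literature.NumberTheory.LFunctions

namespace Konieczny

/-! ## Mixed-radix splitting of `range (q^K)` -/

/-- `∑_{n < aB} F(n) = ∑_{i<a} ∑_{b<B} F(iB + b)`. [folklore] -/
theorem sum_range_mul_eq {M : Type*} [AddCommMonoid M] (F : ℕ → M) (a B : ℕ) :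
    ∑ n ∈ range (a * B), F n = ∑ i ∈ range a, ∑ b ∈ range B, F (i * B + b) := by
  induction a with
  | zero => simp
  | succ a ih => rw [Nat.succ_mul, sum_range_add, ih, sum_range_succ]

/-- `∑_{n < q^{a+b}} F(n) = ∑_{hi < q^b} ∑_{lo < q^a} F(hi q^a + lo)`. [folklore] -/
theorem sum_range_pow_add {M : Type*} [AddCommMonoid M] (F : ℕ → M) (q a b : ℕ) :
    ∑ n ∈ range (q ^ (a + b)), F n =
      ∑ hi ∈ range (q ^ b), ∑ lo ∈ range (q ^ a), F (hi * q ^ a + lo) := by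
  rw [pow_add, mul_comm, sum_range_mul_eq]

/-- A sum of `1`-bounded terms over `range M` has norm `≤ M`. [folklore] -/
theorem norm_sum_range_le_of_le_one {g : ℕ → ℂ} (hg1 : ∀ n, ‖g n‖ ≤ 1) (M : ℕ) (φ : ℕ → ℕ) :
    ‖∑ b ∈ range M, g (φ b)‖ ≤ M := by
  calc ‖∑ b ∈ range M, g (φ b)‖ ≤ ∑ b ∈ range M, ‖g (φ b)‖ := norm_sum_le _ _
    _ ≤ ∑ b ∈ range M, (1 : ℝ) := sum_le_sum fun b _ => hg1 _
    _ = M := by simp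

/-! ## Quasimultiplicativity (Definition 3.1) -/

/-- **`q`-quasimultiplicative sequences with gap `≤ s`** (Konieczny 2020, Definition 3.1, third
item, for `ℂ`-valued sequences): `g(n + m) = g(n) g(m)` for all `n, m ≥ 0` such that `m < q^l`
and `q^{l+s} ∣ n` for some `l ≥ 0` (the digits of `m` and `n` are separated by at least `s`
positions).  The paper also requires `g(0) = 1`; we do not (it is not needed below, and it holds
automatically unless `g ≡ 0`). [cite: Konieczny2020, Definition 3.1] -/
def IsQuasimult (q s : ℕ) (g : ℕ → ℂ) : Prop :=
  ∀ l x y : ℕ, y < q ^ l → q ^ (l + s) ∣ x → g (x + y) = g x * g y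

/-! ## The zones lemma (Lemma 5.3 in multiplicative form) -/

/-- The window defect `δ_{k,l}(g) = 1 - ‖∑_{c<q^l} g(c q^k)‖ / q^l` lies in `[0, 1]` for
`1`-bounded `g`. [folklore] -/
theorem window_defect_mem {q : ℕ} (hq : 2 ≤ q) {g : ℕ → ℂ} (hg1 : ∀ n, ‖g n‖ ≤ 1) (k l : ℕ) :
    0 ≤ 1 - ‖∑ c ∈ range (q ^ l), g (c * q ^ k)‖ / (q : ℝ) ^ l ∧
      1 - ‖∑ c ∈ range (q ^ l), g (c * q ^ k)‖ / (q : ℝ) ^ l ≤ 1 := by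
  have hql : (0 : ℝ) < (q : ℝ) ^ l := by positivity
  constructor
  · rw [sub_nonneg, div_le_one hql]
    have := norm_sum_range_le_of_le_one hg1 (q ^ l) (fun c => c * q ^ k)
    exact_mod_cast this
  · have : 0 ≤ ‖∑ c ∈ range (q ^ l), g (c * q ^ k)‖ / (q : ℝ) ^ l := by positivity
    linarith

/-- **The zones lemma** (Konieczny 2020, Lemma 5.3, multiplicative form).  Let `g` be
`q`-quasimultiplicative with gap `≤ s` and `1`-bounded, and let `[k_j, k_j + l)` (`j ≥ 0`) be
windows with `k_0 ≥ s` and `k_{j+1} ≥ k_j + l + 2s`.  Then for all `t`, all `K` with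
`k_j + l + s ≤ K` for `j < t`, and all `w` with `q^K ∣ w`:
`‖∑_{b<q^K} g(w + b)‖ ≤ q^K ∏_{j<t} (1 - δ_{k_j,l}(g)/q^{2s})`.
[cite: Konieczny2020, Lemma 5.3] -/
theorem zones_bound {q s : ℕ} (hq : 2 ≤ q) {g : ℕ → ℂ} (hg : IsQuasimult q s g)
    (hg1 : ∀ n, ‖g n‖ ≤ 1) (l : ℕ) (k : ℕ → ℕ) (hk0 : ∀ j, s ≤ k j)
    (hksep : ∀ j, k j + l + 2 * s ≤ k (j + 1)) :
    ∀ t K w : ℕ, (∀ j < t, k j + l + s ≤ K) → q ^ K ∣ w →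
      ‖∑ b ∈ range (q ^ K), g (w + b)‖ ≤
        (q : ℝ) ^ K * ∏ j ∈ range t,
          (1 - (1 - ‖∑ c ∈ range (q ^ l), g (c * q ^ k j)‖ / (q : ℝ) ^ l) / (q : ℝ) ^ (2 * s)) := by
  have hq0 : (0 : ℝ) < q := by exact_mod_cast (lt_of_lt_of_le (by norm_num) hq)
  have hqpos : 0 < q := lt_of_lt_of_le (by norm_num) hq
  -- the factors are in `[0, 1]`
  set ρ : ℕ → ℝ := fun j =>
    1 - (1 - ‖∑ c ∈ range (q ^ l), g (c * q ^ k j)‖ / (q : ℝ) ^ l) / (q : ℝ) ^ (2 * s) with hρ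
  have hρ01 : ∀ j, 0 ≤ ρ j ∧ ρ j ≤ 1 := by
    intro j
    obtain ⟨h0, h1⟩ := window_defect_mem hq hg1 (k j) l
    have hq2s : (1 : ℝ) ≤ (q : ℝ) ^ (2 * s) := one_le_pow₀ (by exact_mod_cast hqpos)
    have hq2s0 : (0 : ℝ) < (q : ℝ) ^ (2 * s) := by positivity
    refine ⟨?_, ?_⟩
    · exact sub_nonneg.2 ((div_le_one hq2s0).2 (h1.trans hq2s))
    · exact sub_le_self _ (div_nonneg h0 hq2s0.le)
  have hprod0 : ∀ t, 0 ≤ ∏ j ∈ range t, ρ j := fun t => prod_nonneg fun j _ => (hρ01 j).1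
  -- monotonicity of `k`
  have hkmono : Monotone k := monotone_nat_of_le_succ fun j => by have := hksep j; omega
  intro t
  induction t with
  | zero =>
      intro K w _ _
      rw [prod_range_zero, mul_one]
      exact_mod_cast norm_sum_range_le_of_le_one hg1 (q ^ K) (fun b => w + b)
  | succ t ih =>
      intro K w hK hw
      -- geometry of the top window: `k t = a + s`, `K = a + s + l + s + e`
      obtain ⟨a, ha⟩ : ∃ a, k t = a + s := ⟨k t - s, by have := hk0 t; omega⟩
      obtain ⟨e, he⟩ : ∃ e, K = (a + s + l + s) + e := by
        have := hK t (Nat.lt_succ_self t); exact ⟨K - (a + s + l + s), by omega⟩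
      -- the inductive bound at level `a`
      have hKa : ∀ j < t, k j + l + s ≤ a := by
        intro j hj
        have h1 := hksep j
        have h2 : k (j + 1) ≤ k t := hkmono hj
        omega
      set Pt : ℝ := ∏ j ∈ range t, ρ j with hPt
      have hPt0 : 0 ≤ Pt := hprod0 t
      have hIH : ∀ W, q ^ a ∣ W → ‖∑ b ∈ range (q ^ a), g (W + b)‖ ≤ (q : ℝ) ^ a * Pt :=
        fun W hW => ih a W hKa hW
      -- the defect of the top window
      set Λ : ℝ := ‖∑ c ∈ range (q ^ l), g (c * q ^ (a + s))‖ with hΛ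
      have hΛeq : ‖∑ c ∈ range (q ^ l), g (c * q ^ k t)‖ = Λ := by rw [hΛ, ha]
      have hρt : ρ t = 1 - (1 - Λ / (q : ℝ) ^ l) / (q : ℝ) ^ (2 * s) := by
        simp only [hρ]
        rw [hΛeq]
      -- split the sum over `b < q^K` into digits blocks `(A, u, c, z, b')`
      have hsplit : ∑ b ∈ range (q ^ K), g (w + b) =
          ∑ A ∈ range (q ^ e), ∑ u ∈ range (q ^ s), ∑ z ∈ range (q ^ s), ∑ c ∈ range (q ^ l),
            ∑ b' ∈ range (q ^ a),
              g (w + A * q ^ (a + s + l + s) + u * q ^ (a + s + l) + c * q ^ (a + s) +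
                z * q ^ a + b') := by
        rw [he, sum_range_pow_add]
        refine sum_congr rfl fun A _ => ?_
        rw [sum_range_pow_add]
        refine sum_congr rfl fun u _ => ?_
        rw [sum_range_pow_add]
        refine (sum_congr rfl fun c _ => sum_range_pow_add _ q a s).trans ?_
        rw [sum_comm]
        refine sum_congr rfl fun z _ => sum_congr rfl fun c _ => sum_congr rfl fun b' _ => ?_
        congr 1
        ring
      -- the bound for a general block `(A, u, z)`: `q^l · q^a Pt`, improved by `δ` at `(0, 0)`
      have hblock : ∀ A u z : ℕ,
          ‖∑ c ∈ range (q ^ l), ∑ b' ∈ range (q ^ a),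
              g (w + A * q ^ (a + s + l + s) + u * q ^ (a + s + l) + c * q ^ (a + s) +
                z * q ^ a + b')‖ ≤
            (q : ℝ) ^ l * ((q : ℝ) ^ a * Pt) -
              (if u = 0 ∧ z = 0 then (1 - Λ / (q : ℝ) ^ l) * ((q : ℝ) ^ l * ((q : ℝ) ^ a * Pt))
               else 0) := by
        intro A u z
        have hwdiv : q ^ (a + s + l + s) ∣ w + A * q ^ (a + s + l + s) := by
          refine dvd_add ?_ (dvd_mul_left _ _)
          rw [he] at hw
          exact dvd_trans (pow_dvd_pow q (Nat.le_add_right _ _)) hw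
        split_ifs with huz
        · obtain ⟨rfl, rfl⟩ := huz
          simp only [zero_mul, add_zero]
          -- factorisation by quasimultiplicativity
          have hfac : ∀ c ∈ range (q ^ l), ∀ b' ∈ range (q ^ a),
              g (w + A * q ^ (a + s + l + s) + c * q ^ (a + s) + b') =
                g (w + A * q ^ (a + s + l + s)) * (g (c * q ^ (a + s)) * g b') := by
            intro c hc b' hb'
            rw [mem_range] at hc hb'
            have hy : c * q ^ (a + s) + b' < q ^ (a + s + l) := by
              have h1 : c * q ^ (a + s) + b' < c * q ^ (a + s) + q ^ (a + s) := by
                have : q ^ a ≤ q ^ (a + s) := Nat.pow_le_pow_right hqpos (Nat.le_add_right _ _)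
                omega
              have h2 : (c + 1) * q ^ (a + s) ≤ q ^ l * q ^ (a + s) :=
                Nat.mul_le_mul_right _ hc
              rw [pow_add q (a + s) l, mul_comm (q ^ (a + s))]
              nlinarith
            have step1 := hg (a + s + l) (w + A * q ^ (a + s + l + s)) (c * q ^ (a + s) + b') hy hwdiv
            have step2 := hg a (c * q ^ (a + s)) b' hb' (dvd_mul_left _ _)
            rw [add_assoc, step1, step2]
          rw [sum_congr rfl fun c hc => sum_congr rfl fun b' hb' => hfac c hc b' hb']
          simp_rw [← mul_sum]
          rw [← sum_mul, norm_mul, norm_mul]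
          have h0 := hIH 0 (dvd_zero _)
          simp only [zero_add] at h0
          have hgW := hg1 (w + A * q ^ (a + s + l + s))
          have hΛ' : ‖∑ c ∈ range (q ^ l), g (c * q ^ (a + s))‖ = Λ := rfl
          rw [hΛ']
          have hΛ0 : 0 ≤ Λ := norm_nonneg _
          have hql : (0 : ℝ) < (q : ℝ) ^ l := by positivity
          calc ‖g (w + A * q ^ (a + s + l + s))‖ * (Λ * ‖∑ i ∈ range (q ^ a), g i‖)
              ≤ 1 * (Λ * ((q : ℝ) ^ a * Pt)) := by
                refine mul_le_mul hgW (mul_le_mul_of_nonneg_left h0 hΛ0) (by positivity)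
                  zero_le_one
            _ = (q : ℝ) ^ l * ((q : ℝ) ^ a * Pt) -
                  (1 - Λ / (q : ℝ) ^ l) * ((q : ℝ) ^ l * ((q : ℝ) ^ a * Pt)) := by
                field_simp
                ring
        · rw [sub_zero]
          calc _ ≤ ∑ c ∈ range (q ^ l), ‖∑ b' ∈ range (q ^ a),
                g (w + A * q ^ (a + s + l + s) + u * q ^ (a + s + l) + c * q ^ (a + s) +
                  z * q ^ a + b')‖ := norm_sum_le _ _
            _ ≤ ∑ c ∈ range (q ^ l), (q : ℝ) ^ a * Pt := by
                refine sum_le_sum fun c _ => hIH _ ?_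
                refine dvd_add (dvd_add (dvd_add (dvd_add ?_ ?_) ?_) ?_) (dvd_mul_left _ _)
                · rw [he] at hw
                  exact dvd_trans (pow_dvd_pow q (by omega)) hw
                · exact dvd_mul_of_dvd_right (pow_dvd_pow q (by omega)) _
                · exact dvd_mul_of_dvd_right (pow_dvd_pow q (by omega)) _
                · exact dvd_mul_of_dvd_right (pow_dvd_pow q (by omega)) _
            _ = (q : ℝ) ^ l * ((q : ℝ) ^ a * Pt) := by
                rw [sum_const, card_range, nsmul_eq_mul]; push_cast; ring
      -- sum the block bounds over `(u, z)` and then over `A`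
      have hqs : (0 : ℝ) < (q : ℝ) ^ s := by positivity
      have huz : ∀ A : ℕ, ‖∑ u ∈ range (q ^ s), ∑ z ∈ range (q ^ s), ∑ c ∈ range (q ^ l),
          ∑ b' ∈ range (q ^ a),
            g (w + A * q ^ (a + s + l + s) + u * q ^ (a + s + l) + c * q ^ (a + s) +
              z * q ^ a + b')‖ ≤
          (q : ℝ) ^ s * (q : ℝ) ^ s * ((q : ℝ) ^ l * ((q : ℝ) ^ a * Pt)) -
            (1 - Λ / (q : ℝ) ^ l) * ((q : ℝ) ^ l * ((q : ℝ) ^ a * Pt)) := by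
        intro A
        calc _ ≤ ∑ u ∈ range (q ^ s), ∑ z ∈ range (q ^ s), ‖∑ c ∈ range (q ^ l),
              ∑ b' ∈ range (q ^ a),
                g (w + A * q ^ (a + s + l + s) + u * q ^ (a + s + l) + c * q ^ (a + s) +
                  z * q ^ a + b')‖ :=
              (norm_sum_le _ _).trans (sum_le_sum fun u _ => norm_sum_le _ _)
          _ ≤ ∑ u ∈ range (q ^ s), ∑ z ∈ range (q ^ s), ((q : ℝ) ^ l * ((q : ℝ) ^ a * Pt) -
              (if u = 0 ∧ z = 0 then (1 - Λ / (q : ℝ) ^ l) * ((q : ℝ) ^ l * ((q : ℝ) ^ a * Pt))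
               else 0)) := sum_le_sum fun u _ => sum_le_sum fun z _ => hblock A u z
          _ = _ := by
              rw [sum_comm]
              simp only [sum_sub_distrib, sum_const, card_range, nsmul_eq_mul]
              have hite : ∑ z ∈ range (q ^ s), ∑ u ∈ range (q ^ s),
                  (if u = 0 ∧ z = 0 then (1 - Λ / (q : ℝ) ^ l) * ((q : ℝ) ^ l * ((q : ℝ) ^ a * Pt))
                   else (0 : ℝ)) =
                  (1 - Λ / (q : ℝ) ^ l) * ((q : ℝ) ^ l * ((q : ℝ) ^ a * Pt)) := by
                have h0s : 0 ∈ range (q ^ s) := mem_range.2 (pow_pos hqpos s)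
                rw [sum_eq_single 0, sum_eq_single 0]
                · simp
                · intro u _ hu; simp [hu]
                · intro h; exact absurd h0s h
                · intro z _ hz; exact sum_eq_zero fun u _ => by simp [hz]
                · intro h; exact absurd h0s h
              rw [hite]
              push_cast
              ring
      rw [hsplit]
      calc ‖∑ A ∈ range (q ^ e), ∑ u ∈ range (q ^ s), ∑ z ∈ range (q ^ s), ∑ c ∈ range (q ^ l),
            ∑ b' ∈ range (q ^ a),
              g (w + A * q ^ (a + s + l + s) + u * q ^ (a + s + l) + c * q ^ (a + s) +
                z * q ^ a + b')‖
          ≤ ∑ A ∈ range (q ^ e), ((q : ℝ) ^ s * (q : ℝ) ^ s * ((q : ℝ) ^ l * ((q : ℝ) ^ a * Pt)) -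
              (1 - Λ / (q : ℝ) ^ l) * ((q : ℝ) ^ l * ((q : ℝ) ^ a * Pt))) :=
            (norm_sum_le _ _).trans (sum_le_sum fun A _ => huz A)
        _ = (q : ℝ) ^ K * ∏ j ∈ range (t + 1), ρ j := by
            rw [sum_const, card_range, nsmul_eq_mul, prod_range_succ, ← hPt, hρt, he]
            have hql : (q : ℝ) ^ l ≠ 0 := by positivity
            have hq2s : (q : ℝ) ^ (2 * s) ≠ 0 := by positivity
            push_cast
            field_simp
            ring

/-! ## From the zones lemma to `𝔼_{n<N} g(n) → 0` -/

/-- Block decomposition of `∑_{n<N}`: if all aligned blocks of length `q^K` have sums of norm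
`≤ κ q^K`, then `‖∑_{n<N} g(n)‖ ≤ κ N + q^K`. [folklore] -/
theorem norm_sum_range_le_of_blocks {q : ℕ} (hq : 2 ≤ q) {g : ℕ → ℂ} (hg1 : ∀ n, ‖g n‖ ≤ 1)
    (K : ℕ) {κ : ℝ} (hκ : 0 ≤ κ)
    (hblocks : ∀ w : ℕ, q ^ K ∣ w → ‖∑ b ∈ range (q ^ K), g (w + b)‖ ≤ κ * (q : ℝ) ^ K) (N : ℕ) :
    ‖∑ n ∈ range N, g n‖ ≤ κ * N + (q : ℝ) ^ K := by
  have hqK : 0 < q ^ K := pow_pos (lt_of_lt_of_le (by norm_num) hq) K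
  set A := N / q ^ K with hA
  set c := N % q ^ K with hc
  have hN : N = A * q ^ K + c := by rw [hA, hc, Nat.div_add_mod']
  have hcq : c < q ^ K := Nat.mod_lt N hqK
  rw [hN, sum_range_add, sum_range_mul_eq]
  calc ‖∑ i ∈ range A, ∑ b ∈ range (q ^ K), g (i * q ^ K + b) +
          ∑ x ∈ range c, g (A * q ^ K + x)‖
      ≤ ∑ i ∈ range A, ‖∑ b ∈ range (q ^ K), g (i * q ^ K + b)‖ +
          ‖∑ x ∈ range c, g (A * q ^ K + x)‖ :=
        (norm_add_le _ _).trans (add_le_add (norm_sum_le _ _) le_rfl)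
    _ ≤ ∑ i ∈ range A, κ * (q : ℝ) ^ K + c := by
        refine add_le_add (sum_le_sum fun i _ => hblocks _ (dvd_mul_left _ _)) ?_
        exact norm_sum_range_le_of_le_one hg1 c _
    _ = κ * (A * (q : ℝ) ^ K) + c := by
        rw [sum_const, card_range, nsmul_eq_mul]; ring
    _ ≤ κ * ((A * q ^ K + c : ℕ) : ℝ) + (q : ℝ) ^ K := by
        refine add_le_add ?_ (by exact_mod_cast hcq.le)
        refine mul_le_mul_of_nonneg_left ?_ hκ
        push_cast
        linarith [(Nat.cast_nonneg c : (0 : ℝ) ≤ c)]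

/-- **Konieczny 2020, Proposition 5.4 (1) ⇒ (2), for `q`-quasimultiplicative sequences, in
contrapositive form.**  Let `g` be `q`-quasimultiplicative with gap `≤ s`, `1`-bounded, and
suppose that for some window length `l` the defects `δ_{k,l}(g) = 1 - ‖∑_{c<q^l} g(cq^k)‖/q^l`,
`k = 0, 1, 2, …`, are not summable.  Then `𝔼_{n<N} g(n) → 0`.
[cite: Konieczny2020, Proposition 5.4] -/
theorem tendsto_avg_of_not_summable_delta {q s : ℕ} (hq : 2 ≤ q) {g : ℕ → ℂ}
    (hg : IsQuasimult q s g) (hg1 : ∀ n, ‖g n‖ ≤ 1) (l : ℕ)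
    (hns : ¬ Summable (fun k : ℕ => 1 - ‖∑ c ∈ range (q ^ l), g (c * q ^ k)‖ / (q : ℝ) ^ l)) :
    Tendsto (fun N : ℕ => (N : ℂ)⁻¹ * ∑ n ∈ range N, g n) atTop (𝓝 0) := by
  have hqpos : 0 < q := lt_of_lt_of_le (by norm_num) hq
  have hq0 : (0 : ℝ) < q := by exact_mod_cast hqpos
  set δ : ℕ → ℝ := fun k => 1 - ‖∑ c ∈ range (q ^ l), g (c * q ^ k)‖ / (q : ℝ) ^ l with hδ
  have hδ01 : ∀ k, 0 ≤ δ k ∧ δ k ≤ 1 := fun k => window_defect_mem hq hg1 k l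
  -- a residue class mod `D = l + 2s + 1` along which `δ` is not summable
  set D : ℕ := l + 2 * s + 1 with hD
  haveI : NeZero D := ⟨by omega⟩
  obtain ⟨k₀, hk₀⟩ : ∃ k₀ : ℕ, ¬ Summable (fun n : ℕ => δ (D * n + k₀)) := by
    by_contra hall
    push Not at hall
    apply hns
    have hdec : δ = fun k => ∑ a : ZMod D, {n : ℕ | (n : ZMod D) = a}.indicator δ k := by
      have := Finset.sum_indicator_mod D δ
      ext k
      conv_lhs => rw [this]
      simp only [Finset.sum_apply]
    rw [hdec]
    refine summable_sum fun a _ => ?_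
    have := (summable_indicator_mod_iff_summable D a.val δ).2 (hall a.val)
    rw [ZMod.natCast_zmod_val] at this
    exact this
  -- the spaced sequence of windows `k_j = D (j + 1) + k₀`
  set k : ℕ → ℕ := fun j => D * (j + 1) + k₀ with hk
  have hk0' : ∀ j, s ≤ k j := by
    intro j
    simp only [hk]
    have : D ≤ D * (j + 1) := Nat.le_mul_of_pos_right D (Nat.succ_pos j)
    omega
  have hksep : ∀ j, k j + l + 2 * s ≤ k (j + 1) := by
    intro j
    simp only [hk]
    rw [Nat.mul_succ D (j + 1)]
    omega
  have hns' : ¬ Summable (fun j : ℕ => δ (k j)) := by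
    intro hs
    exact hk₀ ((summable_nat_add_iff (f := fun n : ℕ => δ (D * n + k₀)) 1).1 hs)
  have hdiv := (not_summable_iff_tendsto_nat_atTop_of_nonneg (fun j => (hδ01 (k j)).1)).1 hns'
  -- the products tend to zero
  set ρ : ℕ → ℝ := fun j => 1 - δ (k j) / (q : ℝ) ^ (2 * s) with hρ
  have hq2s : (0 : ℝ) < (q : ℝ) ^ (2 * s) := by positivity
  have hprod_le : ∀ t, ∏ j ∈ range t, ρ j ≤
      Real.exp (-((∑ j ∈ range t, δ (k j)) / (q : ℝ) ^ (2 * s))) := by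
    intro t
    have h : ∑ j ∈ range t, -(δ (k j) / (q : ℝ) ^ (2 * s)) =
        -((∑ j ∈ range t, δ (k j)) / (q : ℝ) ^ (2 * s)) := by
      rw [sum_neg_distrib, Finset.sum_div]
    rw [← h, Real.exp_sum]
    refine prod_le_prod (fun j _ => ?_) (fun j _ => ?_)
    · exact sub_nonneg.2 ((div_le_one hq2s).2
        ((hδ01 (k j)).2.trans (one_le_pow₀ (by exact_mod_cast hqpos))))
    · exact Real.one_sub_le_exp_neg _
  rw [Metric.tendsto_atTop]
  intro ε hε
  -- choose `t` with the product `< ε/4`, then `K`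
  have hev : ∀ᶠ t : ℕ in atTop,
      Real.exp (-((∑ j ∈ range t, δ (k j)) / (q : ℝ) ^ (2 * s))) < ε / 4 := by
    have h1 : Tendsto (fun t : ℕ => -((∑ j ∈ range t, δ (k j)) / (q : ℝ) ^ (2 * s)))
        atTop atBot :=
      tendsto_neg_atTop_atBot.comp (hdiv.atTop_div_const hq2s)
    exact (Real.tendsto_exp_atBot.comp h1).eventually (gt_mem_nhds (by positivity))
  obtain ⟨t, ht⟩ := hev.exists
  set K : ℕ := k t + l + s with hK
  have hKj : ∀ j < t, k j + l + s ≤ K := by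
    intro j hj
    have hkmono : k j ≤ k t := by
      simp only [hk]
      have : D * (j + 1) ≤ D * (t + 1) := Nat.mul_le_mul_left D (by omega)
      omega
    omega
  have hblocks : ∀ w : ℕ, q ^ K ∣ w → ‖∑ b ∈ range (q ^ K), g (w + b)‖ ≤ ε / 4 * (q : ℝ) ^ K := by
    intro w hw
    have h := zones_bound hq hg hg1 l k hk0' hksep t K w hKj hw
    refine h.trans ?_
    rw [mul_comm]
    exact mul_le_mul_of_nonneg_right ((hprod_le t).trans ht.le) (by positivity)
  -- finally, `N` large
  refine ⟨⌈4 * (q : ℝ) ^ K / ε⌉₊ + 1, fun N hN => ?_⟩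
  have hN1 : (1 : ℝ) ≤ N := by exact_mod_cast le_trans (Nat.le_add_left 1 _) hN
  have hNpos : (0 : ℝ) < N := by linarith
  have hNK : 4 * (q : ℝ) ^ K / ε ≤ N := by
    calc 4 * (q : ℝ) ^ K / ε ≤ ⌈4 * (q : ℝ) ^ K / ε⌉₊ := Nat.le_ceil _
      _ ≤ N := by exact_mod_cast le_trans (Nat.le_succ _) hN
  have hqKN : (q : ℝ) ^ K ≤ ε / 4 * N := by
    rw [div_le_iff₀ hε] at hNK
    linarith
  have hsum := norm_sum_range_le_of_blocks hq hg1 K (by positivity) hblocks N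
  rw [dist_zero_right, norm_mul, norm_inv, Complex.norm_natCast]
  calc (N : ℝ)⁻¹ * ‖∑ n ∈ range N, g n‖ ≤ (N : ℝ)⁻¹ * (ε / 4 * N + ε / 4 * N) := by
        gcongr
        linarith
    _ = ε / 2 := by field_simp; ring
    _ < ε := by linarith

end Konieczny

end Literature.NumberTheory.LFunctions
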